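import Summits.BirchSwinnertonDyer.BirchSwinnertonDyer.Theorems.ManinLocalTwoThreeNotTrivialEisensteinReduction
import Summits.BirchSwinnertonDyer.BirchSwinnertonDyer.Theorems.ManinLocalTwoThreeEisensteinIrreducibleFrobeniusData
import Summits.BirchSwinnertonDyer.BirchSwinnertonDyer.Theorems.ThetaPartnerAtTwoMazurTateCongruenceAtTwoRNegDiscTransport
import Literature.NumberTheory.EllipticCurves.KummerImageIsotropyProofs
import Literature.NumberTheory.EllipticCurves.Gamma0CocycleDegeneracyMaps
import HarnessLib

/-!
# Crux `MazurTateCongruenceAtTwoTop` (stmt-BirchSwinnertonDyer-25797 = `MazurTateCongruenceAtTwoR` 21416), K1 row, the Ihara road: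
# the mod-`2` eigensystem `q ↦ a_q(W)` of a curve with `W[2]` irreducible and `Δ_W < 0` is NOT weight-`2` Eisenstein
# (width seat bsd-wall-tp2-p1-w2 g3; `--supports stmt-BirchSwinnertonDyer-25797`; closes nothing)

THEOREMS ONLY; BSD is not proved by any of this. This is the input `hne` («the eigensystem is not `ψ(ℓ) + ℓφ(ℓ)` over `K̄`») of
the es-cell theorem `ManinLocalTwoThree.relativeIharaShiftVanishingBar_holds` / of width seat w3's `eq_zero_of_dilationInvariant`
at `λ = a_q(W) mod 2`, needed by every discharge of the K1 residue (DP₂)/(DI) through Ihara's lemma mod `2`. The tree's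
`not_isEisensteinEigensystem_of_hasIrreducibleModPGaloisRep` carries `p ≠ 2` (and is false at `2` for `C₃`-image); at `2` the
right hypothesis is the `S₃`-image, i.e. `W[2]` irreducible AND `Δ_W < 0` (complex conjugation is a transposition) — both automatic on
the theta habitat (`GoodSS W 2` ⇒ irreducible; `ThetaPartnerXRoute.Δ_neg_of_cmPartner_two`).

PROOF. If `a_ℓ ≡ ψ(ℓ) + ℓφ(ℓ)` for Dirichlet characters `ψ, φ` mod `m` off a finite set `S`, then `a_ℓ` is EVEN for every odd prime
`ℓ ≡ 1 (mod m)` off `S` (`ψ(1) + 1·φ(1) = 1 + 1 = 0` in characteristic `2`). But there is such an `ℓ` with `a_ℓ` ODD: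
§1 a point of exact order `q` (`WeierstrassCurve.exists_addOrderOf_eq`) puts a primitive `q`-th root of unity `ζ` inside `ℚ(W[q])`
(`exists_isPrimitiveRoot_fixed`, Weil pairing); §2 = the es-cell's Theorem A (`…NotTrivialEisensteinOdd`) with the prime-power modulus
replaced by any `q ≥ 2`: an element `σ` fixing `ζ` and fixed-point-free on `W[2]` is a Frobenius `Frob_ℓ` on `W[2q]` (Chebotarev,
`chebotarev_geomTorsion_holds`), whence `ℓ ≡ 1 (mod q)` and `#W̃(𝔽_ℓ)` odd; §3 such a `σ` exists when `Δ_W < 0`: complex conjugation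
`ρ` is an involution moving a point of `W[2]` (`exists_smul_geomTorsion_two_ne_of_Δ_neg`), irreducibility gives a fixed-point-free `τ`
(`not_irreducible_of_forall_exists_smul_eq`), the commutator `ρτρ⁻¹τ⁻¹` fixes `ζ` (Galois acts on `ζ` through powers) and moves a
point (else `ρ` commutes with `τ` and fixes `v + ρv`, `τ(v+ρv)`, hence everything), and `exists_mem_fixedPointFree_of_smul_ne` upgrades
it inside `Stab(ζ)`; §4 assembly on a global minimal model (`q = 2m`).

References: J. Tate, GCFT §2.4 (Chebotarev) [TateGCFT1967]; J.-P. Serre, Invent. Math. 15 (1972) §4–5 [Serre1972];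
H. Darmon, F. Diamond, R. Taylor, *Fermat's Last Theorem* (1995) p. 120 (Eisenstein ideals) [DarmonDiamondTaylor1995];
J. H. Silverman, AEC III Cor. 6.4(b), Cor. 8.1.1 [SilvermanAEC2009].
-/

set_option autoImplicit false
set_option linter.dupNamespace false

noncomputable section

open scoped Classical

open NumberField IsDedekindDomain Field WeierstrassCurve
  Literature.NumberTheory.EllipticCurves Literature.NumberTheory.GaloisRepresentations
  Literature.NumberTheory.EllipticCurves.ModularForms
  Summit.BirchSwinnertonDyer.BirchSwinnertonDyer.Theorems.ManinLocalTwoThree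
  Summit.BirchSwinnertonDyer.BirchSwinnertonDyer.Theorems.SignedTransportAtTwo

namespace Summit.BirchSwinnertonDyer.BirchSwinnertonDyer.Theorems.MazurTateCongruenceAtTwoR

/-! ## §1. A point of exact order `q` -/

section ExactOrder

/-- **A geometric point of exact order `q`** (`q ≥ 1`), in the currency of `exists_isPrimitiveRoot_fixed`: `d • T ≠ 0` for
`0 < d < q` — from `WeierstrassCurve.exists_addOrderOf_eq` (`E[q] ≅ (ℤ/q)²` has an element of order `q`).
[cite: SilvermanAEC2009, Cor. III.6.4(b)] -/
theorem exists_geomTorsion_exactOrder_of_pos (W : WeierstrassCurve ℚ) [W.IsElliptic] {q : ℕ} (hq : 0 < q) :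
    ∃ T : W.geomPoints, ((q : ℕ) : ℤ) • T = 0 ∧ ∀ d : ℕ, 0 < d → d < q → (d : ℤ) • T ≠ 0 := by
  have hqQ : (q : ℚ) ≠ 0 := by exact_mod_cast hq.ne'
  obtain ⟨P₀, hP₀⟩ := WeierstrassCurve.exists_addOrderOf_eq (W := W) hqQ
  refine ⟨(P₀ : W.geomPoints), ?_, fun d hd hdq hd0 ↦ ?_⟩
  · have h := addOrderOf_nsmul_eq_zero P₀
    rw [hP₀] at h
    have h' := congrArg (fun P : geomTorsion W q ↦ (P : W.geomPoints)) h
    simpa only [AddSubmonoidClass.coe_nsmul, natCast_zsmul, ZeroMemClass.coe_zero] using h'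
  · have hne : d • P₀ ≠ 0 := nsmul_ne_zero_of_lt_addOrderOf hd.ne' (by rw [hP₀]; exact hdq)
    apply hne
    apply Subtype.ext
    rw [AddSubmonoidClass.coe_nsmul, ZeroMemClass.coe_zero, ← natCast_zsmul]
    exact hd0

end ExactOrder

/-! ## §2. Theorem A of the es cell at an arbitrary modulus `q ≥ 2` -/

section Chebotarev

/-- **Chebotarev core at any modulus.** For `W` globally minimal, `q ≥ 2`, `S` finite: if for every primitive `q`-th root of unity
`ζ ∈ ℚ̄` some `σ ∈ Γ_ℚ` fixes `ζ` and acts on `W[2]` without non-zero fixed point, then there is a good prime `r ∉ S`, `r ≠ 2`,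
`r ≡ 1 (mod q)` with `#W̃(𝔽_r)` odd. (The es cell's `exists_prime_modEq_one_reductionPointCount_odd_of_exists_fixedPointFree`, verbatim
with `t^{M+1}` replaced by `q`: `ζ ∈ ℚ(W[q])` by §1 + `exists_isPrimitiveRoot_fixed`, `Frob_r` raises `ζ` to the `r`-th power for
`r ∤ q` (`frob_smul_eq_pow_of_pow_eq_one_of_not_dvd`).) [cite: TateGCFT1967, §2.4 (Tchebotarev density theorem)] -/
theorem exists_prime_modEq_one_reductionPointCount_odd_of_exists_fixedPointFree_mod (W : WeierstrassCurve ℚ) [W.IsElliptic]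
    [W.IsGloballyMinimal] {q : ℕ} (hq2 : 2 ≤ q) (S : Finset ℕ)
    (hex : ∀ ζ : AlgebraicClosure ℚ, IsPrimitiveRoot ζ q →
      ∃ σ : absoluteGaloisGroup ℚ, σ • ζ = ζ ∧ ∀ P : W.geomTorsion ((2 : ℕ) : ℤ), P ≠ 0 → σ • P ≠ P) :
    ∃ (r : ℕ) (_ : Fact r.Prime), r ∉ S ∧ r ≠ 2 ∧ r ≡ 1 [MOD q] ∧ W.HasGoodReductionAtPrime r ∧
      ¬ 2 ∣ W.reductionPointCount r := by
  classical
  haveI : Fact (Nat.Prime 2) := ⟨Nat.prime_two⟩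
  have hqpos : 0 < q := by omega
  haveI : NeZero q := ⟨hqpos.ne'⟩
  -- the root of unity and the element `σ`
  obtain ⟨ζ, hζ, hζfix⟩ :=
    exists_isPrimitiveRoot_fixed (E := W) (q := q) hq2 (exists_geomTorsion_exactOrder_of_pos W hqpos)
  obtain ⟨σ, hσζ, hσ⟩ := hex ζ hζ
  -- Chebotarev on `W[2q]` off `S ∪ {2} ∪ primes(q) ∪ {bad primes}`
  have hΔ0 : minimalDiscriminantInt W ≠ 0 := minimalDiscriminantInt_ne_zero W
  let S' : Set ℕ := {ℓ | (ℓ = 2 ∨ ℓ ∣ q) ∨ (ℓ : ℤ) ∣ minimalDiscriminantInt W ∨ ℓ ∈ S}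
  have hS' : S'.Finite := by
    refine ((Set.finite_le_nat (max (max 2 q) (minimalDiscriminantInt W).natAbs)).union
      (S : Set ℕ).toFinite).subset ?_
    rintro ℓ ((rfl | hℓ) | hℓ | hℓ)
    · exact Or.inl (Set.mem_setOf.mpr (le_max_of_le_left (le_max_left _ _)))
    · exact Or.inl (Set.mem_setOf.mpr (le_max_of_le_left (le_max_of_le_right (Nat.le_of_dvd hqpos hℓ))))
    · exact Or.inl (Set.mem_setOf.mpr (le_max_of_le_right
        (Nat.le_of_dvd (Int.natAbs_pos.mpr hΔ0) (Int.natCast_dvd.mp hℓ))))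
    · exact Or.inr hℓ
  have hn0 : ((2 * q : ℕ) : ℤ) ≠ 0 := by exact_mod_cast (Nat.mul_ne_zero two_ne_zero hqpos.ne')
  obtain ⟨ℓ, v, 𝔓, φ, hℓ, hℓS, hv, h𝔓, hφ, hagree⟩ :=
    chebotarev_geomTorsion_holds W ((2 * q : ℕ) : ℤ) hn0 S' hS' σ
  haveI : Fact ℓ.Prime := ⟨hℓ⟩
  have hℓ2 : ℓ ≠ 2 := fun h ↦ hℓS (Or.inl (Or.inl h))
  have hℓq : ¬ ℓ ∣ q := fun h ↦ hℓS (Or.inl (Or.inr h))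
  have hℓΔ : ¬ (ℓ : ℤ) ∣ minimalDiscriminantInt W := fun h ↦ hℓS (Or.inr (Or.inl h))
  have hℓS₀ : ℓ ∉ S := fun h ↦ hℓS (Or.inr (Or.inr h))
  have hgood : W.HasGoodReductionAtPrime ℓ := hasGoodReductionAtPrime_of_not_dvd W ℓ hℓΔ
  -- the Frobenius fixes `ζ`
  have hψ : ∀ T : W.geomTorsion ((q : ℕ) : ℤ), (σ⁻¹ * φ) • T = T := by
    intro T
    have hTq : ((q : ℕ) : ℤ) • (T : W.geomPoints) = 0 := by
      simpa only [AddSubgroup.torsionBy, Submodule.mem_toAddSubgroup, Submodule.mem_torsionBy_iff] using T.2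
    have hT2q : (T : W.geomPoints) ∈ W.geomTorsion ((2 * q : ℕ) : ℤ) := by
      simp only [Submodule.mem_toAddSubgroup, Submodule.mem_torsionBy_iff]
      rw [Nat.cast_mul, mul_smul, hTq, smul_zero]
    have hval : φ • (T : W.geomPoints) = σ • (T : W.geomPoints) := congrArg Subtype.val (hagree ⟨T, hT2q⟩)
    apply Subtype.ext
    rw [AddSubgroup.torsionBy.coe_smul, mul_smul, hval, inv_smul_smul]
  have hφζ : φ • ζ = ζ := by
    have h1 := hζfix _ hψ
    rw [mul_smul] at h1
    have h2' := congrArg (fun x ↦ σ • x) h1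
    simp only [smul_inv_smul] at h2'
    rw [h2', hσζ]
  -- `ℓ ≡ 1 (mod q)`
  have hfrob := frob_smul_eq_pow_of_pow_eq_one_of_not_dvd hℓ hqpos hℓq hv h𝔓 hφ hζ.pow_eq_one
  have hℓ1 : ℓ ≡ 1 [MOD q] := by
    have hz : ζ ^ ℓ = ζ := by rw [← hfrob, hφζ]
    have hne : ζ ≠ 0 := hζ.ne_zero hqpos.ne'
    have h1 : ζ ^ (ℓ - 1) = 1 := by
      have : ζ ^ (ℓ - 1) * ζ = 1 * ζ := by
        rw [← pow_succ, Nat.sub_add_cancel hℓ.one_le, one_mul, hz]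
      exact mul_right_cancel₀ hne this
    have hdvd := (hζ.pow_eq_one_iff_dvd (ℓ - 1)).mp h1
    exact ((Nat.modEq_iff_dvd' hℓ.one_le).mpr hdvd).symm
  -- `#W̃(𝔽_ℓ)` is odd
  refine ⟨ℓ, ⟨hℓ⟩, hℓS₀, hℓ2, hℓ1, hgood, fun hdvd2 ↦ ?_⟩
  obtain ⟨P, hP0, hP⟩ :=
    exists_frobenius_smul_eq_of_dvd_reductionPointCount_holds W 2 ℓ hℓ2 hgood hdvd2 v hv 𝔓 h𝔓 φ hφ
  have hP2 : ((2 : ℕ) : ℤ) • (P : W.geomPoints) = 0 := by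
    simpa only [AddSubgroup.torsionBy, Submodule.mem_toAddSubgroup, Submodule.mem_torsionBy_iff] using P.2
  have hPq : (P : W.geomPoints) ∈ W.geomTorsion ((2 * q : ℕ) : ℤ) := by
    simp only [Submodule.mem_toAddSubgroup, Submodule.mem_torsionBy_iff]
    rw [Nat.cast_mul, mul_comm, mul_smul, hP2, smul_zero]
  have hval : φ • (P : W.geomPoints) = σ • (P : W.geomPoints) := congrArg Subtype.val (hagree ⟨P, hPq⟩)
  apply hσ P hP0
  apply Subtype.ext
  rw [AddSubgroup.torsionBy.coe_smul, ← hval, ← AddSubgroup.torsionBy.coe_smul, hP]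

end Chebotarev


/-! ## §3. `Δ_W < 0` and `W[2]` irreducible: a fixed-point-free element fixing any root of unity -/

section Commutator

/-- **The `S₃`-image supplies a `3`-cycle fixing `ζ`.** For an elliptic `W/ℚ` with `W[2]` irreducible and `Δ_W < 0`, and a primitive
`q`-th root of unity `ζ` (`q ≥ 1`): some `σ ∈ Γ_ℚ` fixes `ζ` and acts on `W[2]` without non-zero fixed point. Complex conjugation `ρ`
(an involution, `natCard_absoluteGaloisGroup_completion`) moves a point of `W[2]` (`exists_smul_geomTorsion_two_ne_of_Δ_neg`) and fixes
`v = P + ρP ≠ 0`; irreducibility gives a fixed-point-free `τ`; the commutator `ρτρ⁻¹τ⁻¹` fixes `ζ` (Galois acts on `ζ` by powers) and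
moves a point (otherwise `ρ` commutes with `τ`, so fixes `τv` as well, hence all of `W[2] = {0, v, τv, v + τv}`); then
`exists_mem_fixedPointFree_of_smul_ne` inside `Stab(ζ)`. [cite: Serre1972, §5.1 (image of `ρ̄_{E,2}`: `ℚ(√Δ) ⊂ ℚ(E[2])`)]
[cite: SilvermanAEC2009, III.§1] -/
theorem exists_fixedPointFree_smul_eq_of_Δ_neg (W : WeierstrassCurve ℚ) [W.IsElliptic]
    (hirr : W.HasIrreducibleModPGaloisRep 2) (hΔ : W.Δ < 0) {q : ℕ} (hq : 0 < q)
    (ζ : AlgebraicClosure ℚ) (hζ : IsPrimitiveRoot ζ q) :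
    ∃ σ : absoluteGaloisGroup ℚ, σ • ζ = ζ ∧ ∀ P : W.geomTorsion ((2 : ℕ) : ℤ), P ≠ 0 → σ • P ≠ P := by
  classical
  haveI : Fact (Nat.Prime 2) := ⟨Nat.prime_two⟩
  -- a fixed-point-free `τ` from irreducibility; the structure of `W[2]`
  obtain ⟨τ, hτ⟩ : ∃ τ : absoluteGaloisGroup ℚ, ∀ P : W.geomTorsion ((2 : ℕ) : ℤ), P ≠ 0 → τ • P ≠ P := by
    by_contra h
    push Not at h
    exact not_irreducible_of_forall_exists_smul_eq W 2 h hirr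
  have h2 : ∀ P : W.geomTorsion ((2 : ℕ) : ℤ), P + P = 0 := by
    intro P
    have hP : ((2 : ℕ) : ℤ) • (P : W.geomPoints) = 0 := by
      simpa only [AddSubgroup.torsionBy, Submodule.mem_toAddSubgroup, Submodule.mem_torsionBy_iff] using P.2
    apply Subtype.ext
    show (P : W.geomPoints) + P = 0
    rw [← two_zsmul]
    exact_mod_cast hP
  have hneg : ∀ P : W.geomTorsion ((2 : ℕ) : ℤ), -P = P := fun P ↦ neg_eq_of_add_eq_zero_left (h2 P)
  have hcard : Nat.card (W.geomTorsion ((2 : ℕ) : ℤ)) = 4 :=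
    card_torsionPoints_eq_sq_holds W (AlgebraicClosure ℚ) (n := 2) (by exact_mod_cast (two_ne_zero : (2 : ℕ) ≠ 0))
  -- the stabiliser of `ζ` is stable under conjugation by `τ`
  haveI : NeZero q := ⟨hq.ne'⟩
  let H : Subgroup (absoluteGaloisGroup ℚ) := MulAction.stabilizer (absoluteGaloisGroup ℚ) ζ
  have hpow : ∀ g : absoluteGaloisGroup ℚ, ∃ a : ℕ, g • ζ = ζ ^ a := by
    intro g
    have hgq : (g • ζ) ^ q = 1 := by rw [← smul_pow', hζ.pow_eq_one, smul_one]
    obtain ⟨a, -, ha⟩ := hζ.eq_pow_of_pow_eq_one hgq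
    exact ⟨a, ha.symm⟩
  have hH : ∀ x ∈ H, τ * x * τ⁻¹ ∈ H := by
    intro x hx
    rw [MulAction.mem_stabilizer_iff] at hx ⊢
    obtain ⟨b, hb⟩ := hpow τ⁻¹
    rw [mul_smul, mul_smul, hb, smul_pow', hx, ← hb, smul_inv_smul]
  -- complex conjugation: an involution `ρ` moving a point of `W[2]`
  obtain ⟨w⟩ : Nonempty (InfinitePlace ℚ) := inferInstance
  have hcardw := natCard_absoluteGaloisGroup_completion w
  haveI : Finite (Field.absoluteGaloisGroup w.Completion) := Nat.finite_of_card_ne_zero (by rw [hcardw]; decide)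
  have hnt : Nontrivial (Field.absoluteGaloisGroup w.Completion) :=
    Finite.one_lt_card_iff_nontrivial.mp (by rw [hcardw]; decide)
  obtain ⟨τ₀, hτ₀⟩ := exists_ne (1 : Field.absoluteGaloisGroup w.Completion)
  obtain ⟨P₁, hP₁⟩ := exists_smul_geomTorsion_two_ne_of_Δ_neg W hΔ w hτ₀
  set ρ : absoluteGaloisGroup ℚ := resGal (K := ℚ) w.Completion τ₀ with hρ
  have hρsq : ρ * ρ = 1 := by
    rw [hρ, ← map_mul, mul_self_eq_one_of_natCard_eq_two hcardw τ₀, map_one]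
  have hρinv : ρ⁻¹ = ρ := inv_eq_of_mul_eq_one_right hρsq
  -- the moved point, as an element of `W[2]` in the `((2 : ℕ) : ℤ)` spelling
  let P : W.geomTorsion ((2 : ℕ) : ℤ) := ⟨(P₁ : W.geomPoints), by
    have := P₁.2
    simpa only [AddSubgroup.torsionBy, Submodule.mem_toAddSubgroup, Submodule.mem_torsionBy_iff, Nat.cast_ofNat] using this⟩
  have hP : ρ • P ≠ P := by
    intro h
    apply hP₁
    apply Subtype.ext
    have h' := congrArg Subtype.val h
    exact h'
  -- `v = P + ρP` is a non-zero fixed point of `ρ`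
  have hv0 : P + ρ • P ≠ 0 := by
    intro h0
    apply hP
    have : ρ • P = -P := eq_neg_of_add_eq_zero_right h0
    rw [this, hneg]
  have hρv : ρ • (P + ρ • P) = P + ρ • P := by
    rw [smul_add, ← mul_smul, hρsq, one_smul, add_comm]
  -- the commutator fixes `ζ`
  set κ : absoluteGaloisGroup ℚ := ρ * τ * ρ⁻¹ * τ⁻¹ with hκ
  have hκζ : κ • ζ = ζ := by
    obtain ⟨a, ha⟩ := hpow τ
    obtain ⟨b, hb⟩ := hpow τ⁻¹
    obtain ⟨c, hc⟩ := hpow ρ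
    have hab : ζ ^ (a * b) = ζ := by
      have : τ • τ⁻¹ • ζ = ζ := smul_inv_smul τ ζ
      rw [hb, smul_pow', ha, ← pow_mul] at this
      exact this
    have hcc : ζ ^ (c * c) = ζ := by
      have : ρ • ρ • ζ = ζ := by rw [← mul_smul, hρsq, one_smul]
      rw [hc, smul_pow', hc, ← pow_mul] at this
      exact this
    rw [hκ, hρinv, mul_smul, mul_smul, mul_smul, hb, smul_pow', hc, ← pow_mul, smul_pow', ha, ← pow_mul, smul_pow', hc,
      ← pow_mul, show c * (a * (c * b)) = (a * b) * (c * c) by ring, pow_mul, hab, hcc]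
  have hκH : κ ∈ H := MulAction.mem_stabilizer_iff.mpr hκζ
  -- the commutator moves a point
  have hκmoves : ∃ Q : W.geomTorsion ((2 : ℕ) : ℤ), κ • Q ≠ Q := by
    by_contra hall
    push Not at hall
    -- `ρ` commutes with `τ` on `W[2]`
    have hcomm : ∀ Q : W.geomTorsion ((2 : ℕ) : ℤ), ρ • τ • Q = τ • ρ • Q := by
      intro Q
      have h1 := hall (τ • ρ • Q)
      rw [hκ, hρinv, mul_smul, mul_smul, mul_smul, inv_smul_smul, ← mul_smul ρ ρ, hρsq, one_smul] at h1
      exact h1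
    -- so `ρ` fixes `τ v`, hence everything
    set v := P + ρ • P with hvdef
    have hρτv : ρ • τ • v = τ • v := by rw [hcomm, hρv]
    have hτv0 : τ • v ≠ 0 := fun h0 ↦ hv0 ((smul_eq_zero_iff_eq τ).mp h0)
    have hτvv : τ • v ≠ v := hτ v hv0
    have hfix : ∀ Q : W.geomTorsion ((2 : ℕ) : ℤ), ρ • Q = Q := by
      intro Q
      rcases eq_zero_or_eq_or_eq_or_eq_add h2 hcard hv0 hτv0 hτvv Q with rfl | rfl | rfl | rfl
      · exact smul_zero ρ
      · exact hρv
      · exact hρτv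
      · rw [smul_add, hρv, hρτv]
    exact hP (hfix P)
  obtain ⟨σ, hσH, hσ⟩ := exists_mem_fixedPointFree_of_smul_ne h2 hcard hτ H hH hκH hκmoves
  exact ⟨σ, MulAction.mem_stabilizer_iff.mp hσH, hσ⟩

end Commutator

/-! ## §4. The eigensystem `a_q(W) mod 2` is not Eisenstein -/

section NotEisenstein

/-- **`q ↦ a_q(W)` is NOT a weight-`2` Eisenstein eigensystem in characteristic `2`** for an elliptic `W/ℚ` with `W[2]` irreducible and
`Δ_W < 0` (image of `ρ̄_{W,2}` = `S₃`): there are no Dirichlet characters `ψ, φ` and finite `S` with `a_ℓ = ψ(ℓ) + ℓφ(ℓ)` in `F` for all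
primes `ℓ ∉ S`. Proof: such a congruence makes `a_ℓ` even for every odd prime `ℓ ≡ 1` (mod the modulus) off `S`, while §2–§3 produce
such an `ℓ` with `#W̃(𝔽_ℓ)` odd, i.e. `a_ℓ` odd. This is the hypothesis `hne` of the dilation-invariance / relative-Ihara vanishing
theorems at `λ = a_q(W)` (K1's Ihara road); the `C₃`-image case (`Δ_W` a square) is genuinely Eisenstein over `𝔽₄` and is excluded.
[cite: DarmonDiamondTaylor1995, p. 120 (Eisenstein maximal ideals)] [cite: TateGCFT1967, §2.4] [cite: Serre1972, §5.1] -/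
theorem not_isEisensteinEigensystem_two_of_Δ_neg (W : WeierstrassCurve ℚ) [W.IsElliptic]
    (hirr : W.HasIrreducibleModPGaloisRep 2) (hΔ : W.Δ < 0) (F : Type) [Field F] [CharP F 2] :
    ¬ IsEisensteinEigensystem 2 (fun ℓ : ℕ ↦ ((W.LFunction ℓ : ℤ) : F)) := by
  classical
  rintro ⟨S, m, ψ, φ, hm, hE⟩
  -- a global minimal model with the same `a_ℓ`, the same `W[2]` and the same sign of `Δ`
  obtain ⟨C, hC⟩ := WeierstrassCurve.hasGlobalMinimalModel_rat_holds W
  haveI := hC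
  have hirr' : (C • W).HasIrreducibleModPGaloisRep 2 :=
    (Mazur1978.hasIrreducibleModPGaloisRep_smul_iff W C 2).mpr hirr
  have hΔ' : (C • W).Δ < 0 := by
    rw [variableChange_Δ]
    have hu : (0 : ℚ) < (C.u⁻¹ : ℚˣ) ^ 12 := by
      have : ((C.u⁻¹ : ℚˣ) : ℚ) ≠ 0 := Units.ne_zero _
      positivity
    exact mul_neg_of_pos_of_neg (by exact_mod_cast hu) hΔ
  -- a good odd prime `r ∉ S`, `r ≡ 1 (mod 2m)`, with `#W̃(𝔽_r)` odd
  have hq2 : 2 ≤ 2 * m := by omega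
  obtain ⟨r, hr, hrS, hr2, hrmod, hgood, hodd⟩ :=
    exists_prime_modEq_one_reductionPointCount_odd_of_exists_fixedPointFree_mod (C • W) hq2 S
      fun ζ hζ ↦ exists_fixedPointFree_smul_eq_of_Δ_neg (C • W) hirr' hΔ' (by omega) ζ hζ
  have hrp : r.Prime := hr.out
  apply hodd
  -- `a_r ≡ ψ(1) + 1·φ(1) = 0` in `F`
  have hmod : r ≡ 1 [MOD m] := by
    rw [mul_comm] at hrmod
    exact Nat.ModEq.of_mul_right 2 hrmod
  have hrm : (r : ZMod m) = 1 := by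
    have := (ZMod.natCast_eq_natCast_iff' r 1 m).mpr hmod
    rwa [Nat.cast_one] at this
  obtain ⟨k, hk⟩ := hrp.odd_of_ne_two hr2
  have hrF : (r : F) = 1 := by
    rw [hk]; push_cast
    rw [CharTwo.two_eq_zero, zero_mul, zero_add]
  have h0 : (((C • W).frobeniusTrace r : ℤ) : F) = 0 := by
    have h : ((W.LFunction r : ℤ) : F) = ψ (r : ZMod m) + (r : F) ^ (2 - 1) * φ (r : ZMod m) := hE r hrp hrS
    rw [← WeierstrassCurve.LFunction_smul W C, (C • W).LFunction_apply_prime_eq_frobeniusTrace r hgood] at h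
    rw [h, hrm, map_one, map_one, hrF, one_pow, one_mul, CharTwo.add_self_eq_zero]
  have hdvd_a : (2 : ℤ) ∣ (C • W).frobeniusTrace r := (CharP.intCast_eq_zero_iff F 2 _).mp h0
  have hdvd_r : (2 : ℤ) ∣ ((r + 1 : ℕ) : ℤ) := ⟨k + 1, by rw [hk]; push_cast; ring⟩
  have h3 : (2 : ℤ) ∣ (C • W).frobeniusTrace r - ((r + 1 : ℕ) : ℤ) := dvd_sub hdvd_a hdvd_r
  exact (dvd_frobeniusTrace_sub_iff (C • W) 2 r).mp (by exact_mod_cast h3)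

end NotEisenstein

end Summit.BirchSwinnertonDyer.BirchSwinnertonDyer.Theorems.MazurTateCongruenceAtTwoR

end
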